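import Summits.BirchSwinnertonDyer.BirchSwinnertonDyer.Theorems.UniversalToricDescentDegreeOnlyTwinSqueeze
import HarnessLib

/-!
# Route `UniversalToricDescent` — TURNKEY kernel⁵: the act-R kernel⁗ (stmt-BirchSwinnertonDyer-27389) re-run on the
# DEGREE-ONLY twin package ♭B′^deg ∧ ♭C₀^deg (crux idea `degree-only-twin-clause`, utd-idea g25, T10)

Cell `bsd-wall`, width seat `bsd-wall-utd-p2-w2` (prover g6, 2026-08-28); `--supports stmt-BirchSwinnertonDyer-27401`
(♭B′ `TwinWanFrameAtThreeMultTresT`; equally ♭C₀_T 27173). Second half of the pen's requested «sorry-free kernel-from-♭B′° closer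
(turnkey, like CloserR)» (pss3x g5, STATUS 13:48:45Z); the squeeze / pointwise kernel in the degree currency are the sibling file
`UniversalToricDescentDegreeOnlyTwinSqueeze`. Degree clause spelled in the route's own profile vocabulary (no new definition) = the
δ-unfolding of utd-idea g25's `DegreeClause` / `FirstUnitIndex`.

## What this file proves (theorems only; every hypothesis displayed; no definition, no named fact, no `sorry`)

* §3 `bsdp_three_of_defectPT_of_degreeBucketsTR_odd` — kernel⁗'s twin trichotomy with resupply
  (`UniversalToricDescentKernelDefectPTTROfPrint.bsdp_three_of_defectPT_of_nonOrdBucketsTR_odd`, pen cert / p619971 §2) on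
  degree-shaped `hB`, `hS0`; the good-ordinary bucket (Yan–Zhu 5.7, IMC equality) feeds the degree clause by §0.
* §4 MONOTONICITY: ♭B′ 27401 ⟹ ♭B′^deg-text and ♭C₀_T 27173 ⟹ ♭C₀^deg-text (so P_R 27405 ⟹ P_deg: every registered line
  still closes the degree items, and kernel⁵ ⟹ kernel⁗).
* §5 **kernel⁵** `bsdp_three_of_degreePackage_of_print` — the text of kernel⁗ `ToricKernelAtThreeApZeroOddDefectPTTROfPrint` with
  its fifth hypothesis `TwinWanFrameAtThreeNonOrdBucketsTR` REPLACED by the degree package (♭B′^deg-text ∧ ♭C₀^deg-text);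
  `twinDegreeFrameNonOrdBuckets_of_nonOrdBucketsTR` (P_R 27405 ⟹ P_deg, so kernel⁵ ⟹ kernel⁗: kernel⁵ is the STRONGER kernel);
  `wAllExclAddWildRankOneSurjTwin_of_degreePackage` — rev 60's `closes` body with P_R ↦ P_deg and hK discharged: the registered
  leaf from the nine displayed hypotheses. A route edit binding P_deg is closed by `fun … ↦ bsdp_three_of_degreePackage_of_print …`.

HONEST FRAMING: CONDITIONAL on every displayed hypothesis (♭T′ 26975 research, 20395 THE WALL, the degree package research for a
universal supplier exactly as ♭ is); nothing here closes an item; BSD is proved for no curve by this file; std axioms only.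
References: [GreenbergVatsal2000] Thm. (1.4); [JetchevSkinnerWan2017] §7.4.1.
-/

noncomputable section

open scoped Classical

set_option linter.dupNamespace false
set_option autoImplicit false


namespace Summit.BirchSwinnertonDyer.BirchSwinnertonDyer.Theorems.UniversalToricDescentKernelDegreeOnlyTwinOfPrint

open WeierstrassCurve NumberField IsDedekindDomain Field
  Literature.NumberTheory.EllipticCurves
  Literature.NumberTheory.EllipticCurves.ModularForms
  Literature.NumberTheory.EllipticCurves.Rank1Residual
  Literature.NumberTheory.EllipticCurves.KrizLi2019
  Literature.NumberTheory.EllipticCurves.LiuZhangZhang2018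
  Summit.BirchSwinnertonDyer.Rank1Residual
  Summit.BirchSwinnertonDyer.Rank1Residual.Additive
  Summit.BirchSwinnertonDyer.Rank1Residual.X11b
  Summit.BirchSwinnertonDyer.Rank1Residual.X11b.AcSelmer
  Summit.BirchSwinnertonDyer.Rank1Residual.X11b.Halves
  Summit.BirchSwinnertonDyer.BirchSwinnertonDyer.Theses.UniversalToricDescent
  Summit.BirchSwinnertonDyer.BirchSwinnertonDyer.Theorems
  Summit.BirchSwinnertonDyer.BirchSwinnertonDyer.Theorems.UniversalToricDescentTwinChoice
  Summit.BirchSwinnertonDyer.BirchSwinnertonDyer.Theorems.UniversalToricDescentWaldspurgerFlat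
  Summit.BirchSwinnertonDyer.BirchSwinnertonDyer.Theorems.UniversalToricDescentKernelOdd
  Summit.BirchSwinnertonDyer.BirchSwinnertonDyer.Theorems.UniversalToricDescentKernelOfPrint
  Summit.BirchSwinnertonDyer.BirchSwinnertonDyer.Theorems.UniversalToricDescentKernelFlatOfPrint
  Summit.BirchSwinnertonDyer.BirchSwinnertonDyer.Theorems.UniversalToricDescentActDFlatGlue
  Summit.BirchSwinnertonDyer.BirchSwinnertonDyer.Theorems.UniversalToricDescentNormProfile
  Summit.BirchSwinnertonDyer.BirchSwinnertonDyer.Theorems.UniversalToricDescentDefectTransport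
  Summit.BirchSwinnertonDyer.BirchSwinnertonDyer.Theorems.UniversalToricDescentDefectPTSqueeze
  Summit.BirchSwinnertonDyer.BirchSwinnertonDyer.Theorems.UniversalToricDescentKernelDefectPTOfPrint
  Summit.BirchSwinnertonDyer.BirchSwinnertonDyer.Theorems.UniversalToricDescentKernelDefectPTTROfPrint
  Summit.BirchSwinnertonDyer.BirchSwinnertonDyer.Theorems.UniversalToricDescentKernelDegreeOnlyTwin

/-! ### §3 The twin trichotomy with resupply on the DEGREE package -/

/-- **kernel⁗'s trichotomy on the degree package** = `UniversalToricDescentKernelDefectPTTROfPrint.bsdp_three_of_defectPT_of_nonOrdBucketsTR_odd`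
with `hB` (multiplicative très ramifié twins) and `hS0` (good supersingular `a₃ = 0` twins) DEGREE-shaped: good ss → `a₃ = 0`
resupply → `hS0`; good ordinary → Yan–Zhu 5.7 (IMC equality ⟹ degree clause, §0); multiplicative très ramifié → `hB`; a
multiplicative peu ramifié twin is first swapped off the locus by the resupply `hres`. [folklore] -/
theorem bsdp_three_of_defectPT_of_degreeBucketsTR_odd (hF : ToricPublishedInputs)
    (hD : DefectTransportModThreePT) (hwall : AdditiveSplitIMCInclusionAtThree) (hmu : TwinMuZeroAtThree)
    (hPT : PoitouTateSelmerStructureDualityFact) (hPT2 : PoitouTateShaTateDualFact) (hYZ : YanZhuMainConjectureInput)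
    (hB : ∀ (W' : WeierstrassCurve ℚ) [W'.IsElliptic] [W'.IsGloballyMinimal] (N' : ℕ) [NeZero N'] (K : Type) [Field K]
      [NumberField K] (Dt' : ModularParametrizationData W' N'),
      Mult W' 3 → W'.HasSurjectiveModNGaloisRep 3 → W'.conductorNorm ℤ = N' → IsImaginaryQuadratic K →
      SatisfiesHeegnerHypothesis N' K → Odd (NumberField.discr K) → ¬ 3 ∣ padicValInt 3 W'.minimalDiscriminantInt →
      ∀ (κ : ZpExtension K 3), κ.IsAnticyclotomic → ∀ (γ : absoluteGaloisGroup K) [Fact (κ.IsTopGenerator γ)]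
        (𝔭 : HeightOneSpectrum (𝓞 K)), ((3 : ℕ) : 𝓞 K) ∈ 𝔭.asIdeal →
        𝔭.asIdeal.ramificationIdx (𝓞 ℚ) = 1 → 𝔭.asIdeal.inertiaDeg (𝓞 ℚ) = 1 →
        ∀ (𝔭' : HeightOneSpectrum (𝓞 K)), ((3 : ℕ) : 𝓞 K) ∈ 𝔭'.asIdeal → 𝔭' ≠ 𝔭 →
        ∀ (ι' : PadicAlgCl 3 ≃+* ℂ), SchneiderFree.BranchInducesPrime 3 ι' 𝔭 →
        ∃ (ΩK : ℂ) (Ωp : ℂ_[3]) (L : UnrSeries 3), ΩK ≠ 0 ∧ Ωp ≠ 0 ∧ IsBDPLFunction ι' 𝔭 κ γ Dt'.f ΩK Ωp L ∧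
          (Module.IsTorsion (IwasawaAlgebra 3) (XAc (W'.baseChange K) 3 κ 𝔭' ∅ γ) →
            ∀ (g : UnrSeries 3) (n m : ℕ),
              (XAc.charIdeal (W'.baseChange K) 3 κ 𝔭' ∅ γ).map (PowerSeries.map (toUnr 3)) = Ideal.span {g} →
              (∀ i < n, ‖((PowerSeries.coeff i g : unrIntegers 3) : ℂ_[3])‖ < 1) ∧
                  ‖((PowerSeries.coeff n g : unrIntegers 3) : ℂ_[3])‖ = 1 →
              (∀ i < m, ‖((PowerSeries.coeff i L : unrIntegers 3) : ℂ_[3])‖ < 1) ∧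
                  ‖((PowerSeries.coeff m L : unrIntegers 3) : ℂ_[3])‖ = 1 →
              m ≤ n))
    (hS0 : ∀ (W' : WeierstrassCurve ℚ) [W'.IsElliptic] [W'.IsGloballyMinimal] (N' : ℕ) [NeZero N'] (K : Type) [Field K]
      [NumberField K] (Dt' : ModularParametrizationData W' N'),
      GoodSS W' 3 → W'.frobeniusTrace 3 = 0 → W'.HasSurjectiveModNGaloisRep 3 → W'.conductorNorm ℤ = N' →
      IsImaginaryQuadratic K → SatisfiesHeegnerHypothesis N' K → Odd (NumberField.discr K) →
      ∀ (κ : ZpExtension K 3), κ.IsAnticyclotomic → ∀ (γ : absoluteGaloisGroup K) [Fact (κ.IsTopGenerator γ)]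
        (𝔭 : HeightOneSpectrum (𝓞 K)), ((3 : ℕ) : 𝓞 K) ∈ 𝔭.asIdeal →
        𝔭.asIdeal.ramificationIdx (𝓞 ℚ) = 1 → 𝔭.asIdeal.inertiaDeg (𝓞 ℚ) = 1 →
        ∀ (𝔭' : HeightOneSpectrum (𝓞 K)), ((3 : ℕ) : 𝓞 K) ∈ 𝔭'.asIdeal → 𝔭' ≠ 𝔭 →
        ∀ (ι' : PadicAlgCl 3 ≃+* ℂ), SchneiderFree.BranchInducesPrime 3 ι' 𝔭 →
        ∃ (ΩK : ℂ) (Ωp : ℂ_[3]) (L : UnrSeries 3), ΩK ≠ 0 ∧ Ωp ≠ 0 ∧ IsBDPLFunction ι' 𝔭 κ γ Dt'.f ΩK Ωp L ∧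
          (Module.IsTorsion (IwasawaAlgebra 3) (XAc (W'.baseChange K) 3 κ 𝔭' ∅ γ) →
            ∀ (g : UnrSeries 3) (n m : ℕ),
              (XAc.charIdeal (W'.baseChange K) 3 κ 𝔭' ∅ γ).map (PowerSeries.map (toUnr 3)) = Ideal.span {g} →
              (∀ i < n, ‖((PowerSeries.coeff i g : unrIntegers 3) : ℂ_[3])‖ < 1) ∧
                  ‖((PowerSeries.coeff n g : unrIntegers 3) : ℂ_[3])‖ = 1 →
              (∀ i < m, ‖((PowerSeries.coeff i L : unrIntegers 3) : ℂ_[3])‖ < 1) ∧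
                  ‖((PowerSeries.coeff m L : unrIntegers 3) : ℂ_[3])‖ = 1 →
              m ≤ n))
    (hsupply : ∀ (W : WeierstrassCurve ℚ) [W.IsElliptic] [W.IsGloballyMinimal], Additive.ClassO6 W 3 →
      W.analyticRank = 1 → W.HasSurjectiveModNGaloisRep 3 → HasGoodSSTwinAtThree W →
      HasGoodSSApZeroTwinAtThree W)
    (hres : ∀ (W : WeierstrassCurve ℚ) [W.IsElliptic] [W.IsGloballyMinimal], Additive.ClassO6 W 3 →
      W.analyticRank = 1 → W.HasSurjectiveModNGaloisRep 3 →
      (∃ (W' : WeierstrassCurve ℚ) (_ : W'.IsElliptic) (_ : W'.IsGloballyMinimal),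
        O6.ModPCongruent W' W 3 ∧ Mult W' 3 ∧ 3 ∣ padicValInt 3 W'.minimalDiscriminantInt) →
      ∃ (W'' : WeierstrassCurve ℚ) (_ : W''.IsElliptic) (_ : W''.IsGloballyMinimal),
        O6.ModPCongruent W'' W 3 ∧ ¬ Addv W'' 3 ∧ (Mult W'' 3 → ¬ 3 ∣ padicValInt 3 W''.minimalDiscriminantInt))
    (hV : ∀ (W : WeierstrassCurve ℚ) [W.IsElliptic] [W.IsGloballyMinimal] (N : ℕ) [NeZero N] (K : Type)
      [Field K] [NumberField K] (Dt : ModularParametrizationData W N) (H : HeegnerDatum N (NumberField.discr K))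
      (ι : K →+* ℂ) (P : (W.baseChange K).toAffine.Point),
      Additive.ClassO6 W 3 → W.HasSurjectiveModNGaloisRep 3 → W.analyticRank = 1 → W.conductorNorm ℤ = N →
      IsImaginaryQuadratic K → SatisfiesHeegnerHypothesis N K → Odd (NumberField.discr K) →
      (W.quadraticTwist (NumberField.discr K : ℚ)).entireLFunction 1 ≠ 0 →
      (WeierstrassCurve.Affine.Point.map ι.toRatAlgHom) P = heegnerPointComplex Dt H → ¬ IsOfFinAddOrder P →
      ∀ (κ : ZpExtension K 3), κ.IsAnticyclotomic → ∀ (γ : absoluteGaloisGroup K) [Fact (κ.IsTopGenerator γ)]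
        (𝔭 : HeightOneSpectrum (𝓞 K)) (h𝔭 : ((3 : ℕ) : 𝓞 K) ∈ 𝔭.asIdeal)
        (he : 𝔭.asIdeal.ramificationIdx (𝓞 ℚ) = 1) (hf : 𝔭.asIdeal.inertiaDeg (𝓞 ℚ) = 1),
        ∃ ι' : PadicAlgCl 3 ≃+* ℂ, SchneiderFree.BranchInducesPrime 3 ι' 𝔭 ∧
          ∃ (ΩK : ℂ) (Ωp : ℂ_[3]) (L : UnrSeries 3), ΩK ≠ 0 ∧ Ωp ≠ 0 ∧ IsBDPLFunction ι' 𝔭 κ γ Dt.f ΩK Ωp L ∧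
            ∃ u : (unrIntegers 3)ˣ, L.HasValueAt 0 ((((u : unrIntegers 3) : unrIntegers 3) : ℂ_[3]) *
              (algebraMap ℚ_[3] ℂ_[3] (logOmega W 3 (embAt K 3 𝔭 h𝔭 he hf) P / (Dt.c : ℚ_[3]))) ^ 2))
    (hC : WildSplitControlAtThree) (hZ : WildRankZeroTwistAtThree) :
    ∀ (W : WeierstrassCurve ℚ) [W.IsElliptic] [W.IsGloballyMinimal], Additive.ClassO6 W 3 →
      W.analyticRank = 1 → W.HasSurjectiveModNGaloisRep 3 →
      (∃ (W' : WeierstrassCurve ℚ) (_ : W'.IsElliptic) (_ : W'.IsGloballyMinimal),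
        O6.ModPCongruent W' W 3 ∧ ¬ Addv W' 3 ∧ W'.HasSurjectiveModNGaloisRep 3) → BSDp W 3 := by
  -- adapted from kernel⁗'s §1 (pen pss3x g5 / p619971 §2); only the three pointwise-kernel calls and the Yan–Zhu bucket change
  intro W _ _ hO6 hr hsurj htwin
  -- the kernel at a twin OFF the peu-ramifié multiplicative locus
  have key : ∀ (W' : WeierstrassCurve ℚ) [W'.IsElliptic] [W'.IsGloballyMinimal], O6.ModPCongruent W' W 3 →
      ¬ Addv W' 3 → (Mult W' 3 → ¬ 3 ∣ padicValInt 3 W'.minimalDiscriminantInt) → BSDp W 3 := by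
    intro W' _ _ hcong hW'ss htres
    have hW'surj : W'.HasSurjectiveModNGaloisRep 3 := by
      obtain ⟨e, he⟩ := hcong
      refine GaloisImage.hasSurjectiveModNGaloisRep_of_torsionIso e.symm (fun σ Q ↦ ?_) hsurj
      apply e.injective
      rw [he, e.apply_symm_apply, e.apply_symm_apply]
    by_cases hgood : W'.HasGoodReductionAtPrime 3
    · by_cases hss : (3 : ℤ) ∣ W'.frobeniusTrace 3
      · obtain ⟨W'', hW''e, hW''m, hcong'', hW''ss, ha0⟩ :=
          hsupply W hO6 hr hsurj ⟨W', ‹_›, ‹_›, hcong, hgood, by exact_mod_cast hss⟩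
        have hW''surj : W''.HasSurjectiveModNGaloisRep 3 := by
          obtain ⟨e, he⟩ := hcong''
          refine GaloisImage.hasSurjectiveModNGaloisRep_of_torsionIso e.symm (fun σ Q ↦ ?_) hsurj
          apply e.injective
          rw [he, e.apply_symm_apply, e.apply_symm_apply]
        exact bsdp_three_of_twinDegreeFrameAt_odd_of_defectPT hF hD hwall hmu hPT hPT2 hV hC hZ W hO6 hr hsurj W'' hcong''
          (fun h ↦ h.1 hW''ss.1)
          (fun N' _ K _ _ Dt' hN hK hHK hodd κ hκ γ _ 𝔭 h𝔭 he hf 𝔭' h𝔭' hne ι' hι ↦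
            hS0 W'' N' K Dt' hW''ss ha0 hW''surj hN hK hHK hodd κ hκ γ 𝔭 h𝔭 he hf 𝔭' h𝔭' hne ι' hι)
      · refine bsdp_three_of_twinDegreeFrameAt_odd_of_defectPT hF hD hwall hmu hPT hPT2 hV hC hZ W hO6 hr hsurj W' hcong
          hW'ss ?_
        intro N' _ K _ _ Dt' hN hK hH hodd κ hκ γ _ 𝔭 h𝔭 he hf 𝔭' h𝔭' hne ι' hι
        obtain ⟨⟨ΩK, Ωp, L', hΩK, hΩp, hBDP'⟩, hall⟩ :=
          ThreeAdicImageOverK.twinSplitIMCAtThreeGoodOrd_of_yanZhu57 hYZ W' N' K Dt'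
            ⟨hgood, by exact_mod_cast hss⟩ hW'surj hN hK hH hodd κ hκ γ 𝔭 h𝔭 he hf 𝔭' h𝔭' hne ι' hι
        exact ⟨ΩK, Ωp, L', hΩK, hΩp, hBDP', fun _ ↦ degreeClause_of_eq_span (hall ΩK Ωp L' hΩK hΩp hBDP')⟩
    · have hmult : W'.HasMultiplicativeReductionAtPrime 3 := by
        by_contra h
        exact hW'ss ⟨hgood, h⟩
      exact bsdp_three_of_twinDegreeFrameAt_odd_of_defectPT hF hD hwall hmu hPT hPT2 hV hC hZ W hO6 hr hsurj W' hcong hW'ss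
        (fun N' _ K _ _ Dt' hN hK hHK hodd κ hκ γ _ 𝔭 h𝔭 he hf 𝔭' h𝔭' hne ι' hι ↦
          hB W' N' K Dt' hmult hW'surj hN hK hHK hodd (htres hmult) κ hκ γ 𝔭 h𝔭 he hf 𝔭' h𝔭' hne ι' hι)
  -- the handed twin is either off that locus (done) or resupplied off it (peu ramifié class)
  obtain ⟨W', hW'e, hW'm, hcong, hW'ss, -⟩ := htwin
  by_cases hpeu : Mult W' 3 ∧ 3 ∣ padicValInt 3 W'.minimalDiscriminantInt
  · obtain ⟨W'', hW''e, hW''m, hcong'', hW''ss, htres''⟩ := hres W hO6 hr hsurj ⟨W', hW'e, hW'm, hcong, hpeu.1, hpeu.2⟩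
    exact key W'' hcong'' hW''ss htres''
  · exact key W' hcong hW'ss (fun hm hdvd ↦ hpeu ⟨hm, hdvd⟩)

/-! ### §4 Monotonicity: ♭ ⟹ ♭^deg (texts), so P_R ⟹ P_deg and kernel⁵ ⟹ kernel⁗ -/

/-- **♭B′ `TwinWanFrameAtThreeMultTresT` (27401) ⟹ ♭B′^deg-text** — every line concluding 27401 (membertower v11, via glue
27935) concludes the degree-only twin. (= utd-idea g25 Sketch §3 `degreeFrameMult_of_wanFrameMult`, words unfolded.) [folklore] -/
theorem twinDegreeFrameMultTresT_of_wanFrame (h : TwinWanFrameAtThreeMultTresT) :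
    ∀ (W' : WeierstrassCurve ℚ) [W'.IsElliptic] [W'.IsGloballyMinimal] (N' : ℕ) [NeZero N'] (K : Type) [Field K]
      [NumberField K] (Dt' : ModularParametrizationData W' N'),
      Mult W' 3 → W'.HasSurjectiveModNGaloisRep 3 → W'.conductorNorm ℤ = N' → IsImaginaryQuadratic K →
      SatisfiesHeegnerHypothesis N' K → Odd (NumberField.discr K) → ¬ 3 ∣ padicValInt 3 W'.minimalDiscriminantInt →
      ∀ (κ : ZpExtension K 3), κ.IsAnticyclotomic → ∀ (γ : absoluteGaloisGroup K) [Fact (κ.IsTopGenerator γ)]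
        (𝔭 : HeightOneSpectrum (𝓞 K)), ((3 : ℕ) : 𝓞 K) ∈ 𝔭.asIdeal →
        𝔭.asIdeal.ramificationIdx (𝓞 ℚ) = 1 → 𝔭.asIdeal.inertiaDeg (𝓞 ℚ) = 1 →
        ∀ (𝔭' : HeightOneSpectrum (𝓞 K)), ((3 : ℕ) : 𝓞 K) ∈ 𝔭'.asIdeal → 𝔭' ≠ 𝔭 →
        ∀ (ι' : PadicAlgCl 3 ≃+* ℂ), SchneiderFree.BranchInducesPrime 3 ι' 𝔭 →
        ∃ (ΩK : ℂ) (Ωp : ℂ_[3]) (L : UnrSeries 3), ΩK ≠ 0 ∧ Ωp ≠ 0 ∧ IsBDPLFunction ι' 𝔭 κ γ Dt'.f ΩK Ωp L ∧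
          (Module.IsTorsion (IwasawaAlgebra 3) (XAc (W'.baseChange K) 3 κ 𝔭' ∅ γ) →
            ∀ (g : UnrSeries 3) (n m : ℕ),
              (XAc.charIdeal (W'.baseChange K) 3 κ 𝔭' ∅ γ).map (PowerSeries.map (toUnr 3)) = Ideal.span {g} →
              (∀ i < n, ‖((PowerSeries.coeff i g : unrIntegers 3) : ℂ_[3])‖ < 1) ∧
                  ‖((PowerSeries.coeff n g : unrIntegers 3) : ℂ_[3])‖ = 1 →
              (∀ i < m, ‖((PowerSeries.coeff i L : unrIntegers 3) : ℂ_[3])‖ < 1) ∧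
                  ‖((PowerSeries.coeff m L : unrIntegers 3) : ℂ_[3])‖ = 1 →
              m ≤ n) := by
  intro W' _ _ N' _ K _ _ Dt' hmult hsurj hN' hK hHN' hodd htres κ hκ γ _ 𝔭 h𝔭 he hf 𝔭' h𝔭' hne ι' hind
  obtain ⟨ΩK, Ωp, L, hΩK, hΩp, hBDP, hwan⟩ :=
    h W' N' K Dt' hmult hsurj hN' hK hHN' hodd htres κ hκ γ 𝔭 h𝔭 he hf 𝔭' h𝔭' hne ι' hind
  exact ⟨ΩK, Ωp, L, hΩK, hΩp, hBDP, fun htors ↦ degreeClause_of_wanClause (hwan htors)⟩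

/-- **♭C₀_T `TwinWanFrameAtThreeGoodSSApZeroT` (27173) ⟹ ♭C₀^deg-text** — every line concluding 27173 concludes the degree-only
twin. (= utd-idea g25 Sketch §3 `degreeFrame_of_wanFrame`, words unfolded.) [folklore] -/
theorem twinDegreeFrameGoodSSApZeroT_of_wanFrame (h : TwinWanFrameAtThreeGoodSSApZeroT) :
    ∀ (W' : WeierstrassCurve ℚ) [W'.IsElliptic] [W'.IsGloballyMinimal] (N' : ℕ) [NeZero N'] (K : Type) [Field K]
      [NumberField K] (Dt' : ModularParametrizationData W' N'),
      GoodSS W' 3 → W'.frobeniusTrace 3 = 0 → W'.HasSurjectiveModNGaloisRep 3 → W'.conductorNorm ℤ = N' →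
      IsImaginaryQuadratic K → SatisfiesHeegnerHypothesis N' K → Odd (NumberField.discr K) →
      ∀ (κ : ZpExtension K 3), κ.IsAnticyclotomic → ∀ (γ : absoluteGaloisGroup K) [Fact (κ.IsTopGenerator γ)]
        (𝔭 : HeightOneSpectrum (𝓞 K)), ((3 : ℕ) : 𝓞 K) ∈ 𝔭.asIdeal →
        𝔭.asIdeal.ramificationIdx (𝓞 ℚ) = 1 → 𝔭.asIdeal.inertiaDeg (𝓞 ℚ) = 1 →
        ∀ (𝔭' : HeightOneSpectrum (𝓞 K)), ((3 : ℕ) : 𝓞 K) ∈ 𝔭'.asIdeal → 𝔭' ≠ 𝔭 →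
        ∀ (ι' : PadicAlgCl 3 ≃+* ℂ), SchneiderFree.BranchInducesPrime 3 ι' 𝔭 →
        ∃ (ΩK : ℂ) (Ωp : ℂ_[3]) (L : UnrSeries 3), ΩK ≠ 0 ∧ Ωp ≠ 0 ∧ IsBDPLFunction ι' 𝔭 κ γ Dt'.f ΩK Ωp L ∧
          (Module.IsTorsion (IwasawaAlgebra 3) (XAc (W'.baseChange K) 3 κ 𝔭' ∅ γ) →
            ∀ (g : UnrSeries 3) (n m : ℕ),
              (XAc.charIdeal (W'.baseChange K) 3 κ 𝔭' ∅ γ).map (PowerSeries.map (toUnr 3)) = Ideal.span {g} →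
              (∀ i < n, ‖((PowerSeries.coeff i g : unrIntegers 3) : ℂ_[3])‖ < 1) ∧
                  ‖((PowerSeries.coeff n g : unrIntegers 3) : ℂ_[3])‖ = 1 →
              (∀ i < m, ‖((PowerSeries.coeff i L : unrIntegers 3) : ℂ_[3])‖ < 1) ∧
                  ‖((PowerSeries.coeff m L : unrIntegers 3) : ℂ_[3])‖ = 1 →
              m ≤ n) := by
  intro W' _ _ N' _ K _ _ Dt' hss ha hsurj hN' hK hHN' hodd κ hκ γ _ 𝔭 h𝔭 he hf 𝔭' h𝔭' hne ι' hind
  obtain ⟨ΩK, Ωp, L, hΩK, hΩp, hBDP, hwan⟩ :=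
    h W' N' K Dt' hss ha hsurj hN' hK hHN' hodd κ hκ γ 𝔭 h𝔭 he hf 𝔭' h𝔭' hne ι' hind
  exact ⟨ΩK, Ωp, L, hΩK, hΩp, hBDP, fun htors ↦ degreeClause_of_wanClause (hwan htors)⟩

/-! ### §5 kernel⁵ and the leaf from the degree package -/

/-- **kernel⁵ (TURNKEY for T10)** — the text of kernel⁗ `ToricKernelAtThreeApZeroOddDefectPTTROfPrint` (27389) with its fifth
hypothesis, the twin package P_R `TwinWanFrameAtThreeNonOrdBucketsTR` (27405 = ♭B′ 27401 ∧ ♭C₀_T 27173), REPLACED by the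
DEGREE package ♭B′^deg-text ∧ ♭C₀^deg-text (utd-idea g25 `TwinDegreeFrameAtThreeMultTresT ∧ TwinDegreeFrameAtThreeGoodSSApZeroT`,
words unfolded). Proof = kernel⁗'s §2 with §3 above. A route whose `closes` binds P_deg instead of P_R is closed by
`fun hF hD hA hM h3 … ↦ bsdp_three_of_degreePackage_of_print hF hD hA hM h3 …` (see `wAllExclAddWildRankOneSurjTwin_of_degreePackage`).
CONDITIONAL on every displayed hypothesis; BSD is proved for no curve by this. [folklore] -/
theorem bsdp_three_of_degreePackage_of_print (hF : ToricPublishedInputs) (hD : DefectTransportModThreePT)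
    (hA : AdditiveSplitIMCInclusionAtThree) (hM : TwinMuZeroAtThree)
    (h3 : (∀ (W' : WeierstrassCurve ℚ) [W'.IsElliptic] [W'.IsGloballyMinimal] (N' : ℕ) [NeZero N'] (K : Type) [Field K]
      [NumberField K] (Dt' : ModularParametrizationData W' N'),
      Mult W' 3 → W'.HasSurjectiveModNGaloisRep 3 → W'.conductorNorm ℤ = N' → IsImaginaryQuadratic K →
      SatisfiesHeegnerHypothesis N' K → Odd (NumberField.discr K) → ¬ 3 ∣ padicValInt 3 W'.minimalDiscriminantInt →
      ∀ (κ : ZpExtension K 3), κ.IsAnticyclotomic → ∀ (γ : absoluteGaloisGroup K) [Fact (κ.IsTopGenerator γ)]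
        (𝔭 : HeightOneSpectrum (𝓞 K)), ((3 : ℕ) : 𝓞 K) ∈ 𝔭.asIdeal →
        𝔭.asIdeal.ramificationIdx (𝓞 ℚ) = 1 → 𝔭.asIdeal.inertiaDeg (𝓞 ℚ) = 1 →
        ∀ (𝔭' : HeightOneSpectrum (𝓞 K)), ((3 : ℕ) : 𝓞 K) ∈ 𝔭'.asIdeal → 𝔭' ≠ 𝔭 →
        ∀ (ι' : PadicAlgCl 3 ≃+* ℂ), SchneiderFree.BranchInducesPrime 3 ι' 𝔭 →
        ∃ (ΩK : ℂ) (Ωp : ℂ_[3]) (L : UnrSeries 3), ΩK ≠ 0 ∧ Ωp ≠ 0 ∧ IsBDPLFunction ι' 𝔭 κ γ Dt'.f ΩK Ωp L ∧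
          (Module.IsTorsion (IwasawaAlgebra 3) (XAc (W'.baseChange K) 3 κ 𝔭' ∅ γ) →
            ∀ (g : UnrSeries 3) (n m : ℕ),
              (XAc.charIdeal (W'.baseChange K) 3 κ 𝔭' ∅ γ).map (PowerSeries.map (toUnr 3)) = Ideal.span {g} →
              (∀ i < n, ‖((PowerSeries.coeff i g : unrIntegers 3) : ℂ_[3])‖ < 1) ∧
                  ‖((PowerSeries.coeff n g : unrIntegers 3) : ℂ_[3])‖ = 1 →
              (∀ i < m, ‖((PowerSeries.coeff i L : unrIntegers 3) : ℂ_[3])‖ < 1) ∧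
                  ‖((PowerSeries.coeff m L : unrIntegers 3) : ℂ_[3])‖ = 1 →
              m ≤ n)) ∧
      (∀ (W' : WeierstrassCurve ℚ) [W'.IsElliptic] [W'.IsGloballyMinimal] (N' : ℕ) [NeZero N'] (K : Type) [Field K]
      [NumberField K] (Dt' : ModularParametrizationData W' N'),
      GoodSS W' 3 → W'.frobeniusTrace 3 = 0 → W'.HasSurjectiveModNGaloisRep 3 → W'.conductorNorm ℤ = N' →
      IsImaginaryQuadratic K → SatisfiesHeegnerHypothesis N' K → Odd (NumberField.discr K) →
      ∀ (κ : ZpExtension K 3), κ.IsAnticyclotomic → ∀ (γ : absoluteGaloisGroup K) [Fact (κ.IsTopGenerator γ)]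
        (𝔭 : HeightOneSpectrum (𝓞 K)), ((3 : ℕ) : 𝓞 K) ∈ 𝔭.asIdeal →
        𝔭.asIdeal.ramificationIdx (𝓞 ℚ) = 1 → 𝔭.asIdeal.inertiaDeg (𝓞 ℚ) = 1 →
        ∀ (𝔭' : HeightOneSpectrum (𝓞 K)), ((3 : ℕ) : 𝓞 K) ∈ 𝔭'.asIdeal → 𝔭' ≠ 𝔭 →
        ∀ (ι' : PadicAlgCl 3 ≃+* ℂ), SchneiderFree.BranchInducesPrime 3 ι' 𝔭 →
        ∃ (ΩK : ℂ) (Ωp : ℂ_[3]) (L : UnrSeries 3), ΩK ≠ 0 ∧ Ωp ≠ 0 ∧ IsBDPLFunction ι' 𝔭 κ γ Dt'.f ΩK Ωp L ∧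
          (Module.IsTorsion (IwasawaAlgebra 3) (XAc (W'.baseChange K) 3 κ 𝔭' ∅ γ) →
            ∀ (g : UnrSeries 3) (n m : ℕ),
              (XAc.charIdeal (W'.baseChange K) 3 κ 𝔭' ∅ γ).map (PowerSeries.map (toUnr 3)) = Ideal.span {g} →
              (∀ i < n, ‖((PowerSeries.coeff i g : unrIntegers 3) : ℂ_[3])‖ < 1) ∧
                  ‖((PowerSeries.coeff n g : unrIntegers 3) : ℂ_[3])‖ = 1 →
              (∀ i < m, ‖((PowerSeries.coeff i L : unrIntegers 3) : ℂ_[3])‖ < 1) ∧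
                  ‖((PowerSeries.coeff m L : unrIntegers 3) : ℂ_[3])‖ = 1 →
              m ≤ n)))
    (hsupply : GoodSSApZeroTwinSupplyAtThree) (hres : PeuRamifieMultTwinResupplyAtThree)
    (hW : WildSplitPrintedInputsAtThree) (hS : WildSplitFrameAtThreeOddOfPrint) (hL : ToricPrintedLeavesAtThree)
    (hZ : WildRankZeroTwistAtThree) :
    ∀ (W : WeierstrassCurve ℚ) [W.IsElliptic] [W.IsGloballyMinimal], Additive.ClassO6 W 3 →
      W.analyticRank = 1 → W.HasSurjectiveModNGaloisRep 3 →
      (∃ (W' : WeierstrassCurve ℚ) (_ : W'.IsElliptic) (_ : W'.IsGloballyMinimal),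
        O6.ModPCongruent W' W 3 ∧ ¬ Addv W' 3 ∧ W'.HasSurjectiveModNGaloisRep 3) → BSDp W 3 := by
  -- kernel⁗'s §2 (`toricKernelAtThreeApZeroOddDefectPTTROfPrint_proof`) with §3 above in place of its §1
  obtain ⟨hYZ, h1, h2⟩ := hL
  obtain ⟨hH, hB', hLZZ⟩ := hW
  obtain ⟨hB, hS0⟩ := h3
  exact bsdp_three_of_defectPT_of_degreeBucketsTR_odd hF hD hA hM h1 h2 hYZ
    (fun W' _ _ N' _ K _ _ Dt' hm hsurj hN hK hH hodd hnd κ hκ γ _ 𝔭 h𝔭 he hf 𝔭' h𝔭' hne ι' hι ↦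
      hB W' N' K Dt' hm hsurj hN hK hH hodd hnd κ hκ γ 𝔭 h𝔭 he hf 𝔭' h𝔭' hne ι' hι)
    (fun W' _ _ N' _ K _ _ Dt' hg ha hsurj hN hK hH hodd κ hκ γ _ 𝔭 h𝔭 he hf 𝔭' h𝔭' hne ι' hι ↦
      hS0 W' N' K Dt' hg ha hsurj hN hK hH hodd κ hκ γ 𝔭 h𝔭 he hf 𝔭' h𝔭' hne ι' hι)
    (fun W _ _ hO6 hr hsurj htwin ↦ hsupply W hO6 hr hsurj htwin)
    (fun W _ _ hO6 hr hsurj htwin ↦ hres W hO6 hr hsurj htwin)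
    (UniversalToricDescentKernelOdd.wildSplitWaldspurgerAtThreeOdd_of_lzz_of_frameOdd hLZZ (hS hH hB'))
    (UniversalToricDescentControl.wildSplitControlAtThree_of_poitouTate h1 h2) hZ

/-- **P_R ⟹ P_deg** — the act-R twin package `TwinWanFrameAtThreeNonOrdBucketsTR` (27405 = ♭B′ 27401 ∧ ♭C₀_T 27173) implies the
DEGREE package (♭B′^deg-text ∧ ♭C₀^deg-text) by §4; hence kernel⁵ (below, hypothesis P_deg) implies kernel⁗ (hypothesis P_R,
27389 — already closed by its own proof `toricKernelAtThreeApZeroOddDefectPTTROfPrint_proof`, not restated here): re-keying `closes`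
from P_R to P_deg loses nothing landed. [folklore] -/
theorem twinDegreeFrameNonOrdBuckets_of_nonOrdBucketsTR (h : TwinWanFrameAtThreeNonOrdBucketsTR) :
    (∀ (W' : WeierstrassCurve ℚ) [W'.IsElliptic] [W'.IsGloballyMinimal] (N' : ℕ) [NeZero N'] (K : Type) [Field K]
      [NumberField K] (Dt' : ModularParametrizationData W' N'),
      Mult W' 3 → W'.HasSurjectiveModNGaloisRep 3 → W'.conductorNorm ℤ = N' → IsImaginaryQuadratic K →
      SatisfiesHeegnerHypothesis N' K → Odd (NumberField.discr K) → ¬ 3 ∣ padicValInt 3 W'.minimalDiscriminantInt →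
      ∀ (κ : ZpExtension K 3), κ.IsAnticyclotomic → ∀ (γ : absoluteGaloisGroup K) [Fact (κ.IsTopGenerator γ)]
        (𝔭 : HeightOneSpectrum (𝓞 K)), ((3 : ℕ) : 𝓞 K) ∈ 𝔭.asIdeal →
        𝔭.asIdeal.ramificationIdx (𝓞 ℚ) = 1 → 𝔭.asIdeal.inertiaDeg (𝓞 ℚ) = 1 →
        ∀ (𝔭' : HeightOneSpectrum (𝓞 K)), ((3 : ℕ) : 𝓞 K) ∈ 𝔭'.asIdeal → 𝔭' ≠ 𝔭 →
        ∀ (ι' : PadicAlgCl 3 ≃+* ℂ), SchneiderFree.BranchInducesPrime 3 ι' 𝔭 →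
        ∃ (ΩK : ℂ) (Ωp : ℂ_[3]) (L : UnrSeries 3), ΩK ≠ 0 ∧ Ωp ≠ 0 ∧ IsBDPLFunction ι' 𝔭 κ γ Dt'.f ΩK Ωp L ∧
          (Module.IsTorsion (IwasawaAlgebra 3) (XAc (W'.baseChange K) 3 κ 𝔭' ∅ γ) →
            ∀ (g : UnrSeries 3) (n m : ℕ),
              (XAc.charIdeal (W'.baseChange K) 3 κ 𝔭' ∅ γ).map (PowerSeries.map (toUnr 3)) = Ideal.span {g} →
              (∀ i < n, ‖((PowerSeries.coeff i g : unrIntegers 3) : ℂ_[3])‖ < 1) ∧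
                  ‖((PowerSeries.coeff n g : unrIntegers 3) : ℂ_[3])‖ = 1 →
              (∀ i < m, ‖((PowerSeries.coeff i L : unrIntegers 3) : ℂ_[3])‖ < 1) ∧
                  ‖((PowerSeries.coeff m L : unrIntegers 3) : ℂ_[3])‖ = 1 →
              m ≤ n)) ∧
      (∀ (W' : WeierstrassCurve ℚ) [W'.IsElliptic] [W'.IsGloballyMinimal] (N' : ℕ) [NeZero N'] (K : Type) [Field K]
      [NumberField K] (Dt' : ModularParametrizationData W' N'),
      GoodSS W' 3 → W'.frobeniusTrace 3 = 0 → W'.HasSurjectiveModNGaloisRep 3 → W'.conductorNorm ℤ = N' →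
      IsImaginaryQuadratic K → SatisfiesHeegnerHypothesis N' K → Odd (NumberField.discr K) →
      ∀ (κ : ZpExtension K 3), κ.IsAnticyclotomic → ∀ (γ : absoluteGaloisGroup K) [Fact (κ.IsTopGenerator γ)]
        (𝔭 : HeightOneSpectrum (𝓞 K)), ((3 : ℕ) : 𝓞 K) ∈ 𝔭.asIdeal →
        𝔭.asIdeal.ramificationIdx (𝓞 ℚ) = 1 → 𝔭.asIdeal.inertiaDeg (𝓞 ℚ) = 1 →
        ∀ (𝔭' : HeightOneSpectrum (𝓞 K)), ((3 : ℕ) : 𝓞 K) ∈ 𝔭'.asIdeal → 𝔭' ≠ 𝔭 →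
        ∀ (ι' : PadicAlgCl 3 ≃+* ℂ), SchneiderFree.BranchInducesPrime 3 ι' 𝔭 →
        ∃ (ΩK : ℂ) (Ωp : ℂ_[3]) (L : UnrSeries 3), ΩK ≠ 0 ∧ Ωp ≠ 0 ∧ IsBDPLFunction ι' 𝔭 κ γ Dt'.f ΩK Ωp L ∧
          (Module.IsTorsion (IwasawaAlgebra 3) (XAc (W'.baseChange K) 3 κ 𝔭' ∅ γ) →
            ∀ (g : UnrSeries 3) (n m : ℕ),
              (XAc.charIdeal (W'.baseChange K) 3 κ 𝔭' ∅ γ).map (PowerSeries.map (toUnr 3)) = Ideal.span {g} →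
              (∀ i < n, ‖((PowerSeries.coeff i g : unrIntegers 3) : ℂ_[3])‖ < 1) ∧
                  ‖((PowerSeries.coeff n g : unrIntegers 3) : ℂ_[3])‖ = 1 →
              (∀ i < m, ‖((PowerSeries.coeff i L : unrIntegers 3) : ℂ_[3])‖ < 1) ∧
                  ‖((PowerSeries.coeff m L : unrIntegers 3) : ℂ_[3])‖ = 1 →
              m ≤ n)) :=
  ⟨twinDegreeFrameMultTresT_of_wanFrame h.1, twinDegreeFrameGoodSSApZeroT_of_wanFrame h.2⟩

/-- **The registered leaf from the DEGREE package**: rev 60's `closes` body with P_R ↦ P_deg and its kernel hypothesis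
DISCHARGED by kernel⁵ — `WAllExclAddWildRankOneSurjTwin` from the nine remaining displayed hypotheses (CONDITIONAL on every
one of them: ♭T′ inside `hP` is research, 20395 is THE WALL, the degree package is research for a universal supplier; closes
nothing by itself; BSD is proved for no curve). [folklore] -/
theorem wAllExclAddWildRankOneSurjTwin_of_degreePackage (hF : ToricPublishedInputs) (hP : ToricDefectWallMuAtThree)
    (h3 : (∀ (W' : WeierstrassCurve ℚ) [W'.IsElliptic] [W'.IsGloballyMinimal] (N' : ℕ) [NeZero N'] (K : Type) [Field K]
      [NumberField K] (Dt' : ModularParametrizationData W' N'),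
      Mult W' 3 → W'.HasSurjectiveModNGaloisRep 3 → W'.conductorNorm ℤ = N' → IsImaginaryQuadratic K →
      SatisfiesHeegnerHypothesis N' K → Odd (NumberField.discr K) → ¬ 3 ∣ padicValInt 3 W'.minimalDiscriminantInt →
      ∀ (κ : ZpExtension K 3), κ.IsAnticyclotomic → ∀ (γ : absoluteGaloisGroup K) [Fact (κ.IsTopGenerator γ)]
        (𝔭 : HeightOneSpectrum (𝓞 K)), ((3 : ℕ) : 𝓞 K) ∈ 𝔭.asIdeal →
        𝔭.asIdeal.ramificationIdx (𝓞 ℚ) = 1 → 𝔭.asIdeal.inertiaDeg (𝓞 ℚ) = 1 →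
        ∀ (𝔭' : HeightOneSpectrum (𝓞 K)), ((3 : ℕ) : 𝓞 K) ∈ 𝔭'.asIdeal → 𝔭' ≠ 𝔭 →
        ∀ (ι' : PadicAlgCl 3 ≃+* ℂ), SchneiderFree.BranchInducesPrime 3 ι' 𝔭 →
        ∃ (ΩK : ℂ) (Ωp : ℂ_[3]) (L : UnrSeries 3), ΩK ≠ 0 ∧ Ωp ≠ 0 ∧ IsBDPLFunction ι' 𝔭 κ γ Dt'.f ΩK Ωp L ∧
          (Module.IsTorsion (IwasawaAlgebra 3) (XAc (W'.baseChange K) 3 κ 𝔭' ∅ γ) →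
            ∀ (g : UnrSeries 3) (n m : ℕ),
              (XAc.charIdeal (W'.baseChange K) 3 κ 𝔭' ∅ γ).map (PowerSeries.map (toUnr 3)) = Ideal.span {g} →
              (∀ i < n, ‖((PowerSeries.coeff i g : unrIntegers 3) : ℂ_[3])‖ < 1) ∧
                  ‖((PowerSeries.coeff n g : unrIntegers 3) : ℂ_[3])‖ = 1 →
              (∀ i < m, ‖((PowerSeries.coeff i L : unrIntegers 3) : ℂ_[3])‖ < 1) ∧
                  ‖((PowerSeries.coeff m L : unrIntegers 3) : ℂ_[3])‖ = 1 →
              m ≤ n)) ∧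
      (∀ (W' : WeierstrassCurve ℚ) [W'.IsElliptic] [W'.IsGloballyMinimal] (N' : ℕ) [NeZero N'] (K : Type) [Field K]
      [NumberField K] (Dt' : ModularParametrizationData W' N'),
      GoodSS W' 3 → W'.frobeniusTrace 3 = 0 → W'.HasSurjectiveModNGaloisRep 3 → W'.conductorNorm ℤ = N' →
      IsImaginaryQuadratic K → SatisfiesHeegnerHypothesis N' K → Odd (NumberField.discr K) →
      ∀ (κ : ZpExtension K 3), κ.IsAnticyclotomic → ∀ (γ : absoluteGaloisGroup K) [Fact (κ.IsTopGenerator γ)]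
        (𝔭 : HeightOneSpectrum (𝓞 K)), ((3 : ℕ) : 𝓞 K) ∈ 𝔭.asIdeal →
        𝔭.asIdeal.ramificationIdx (𝓞 ℚ) = 1 → 𝔭.asIdeal.inertiaDeg (𝓞 ℚ) = 1 →
        ∀ (𝔭' : HeightOneSpectrum (𝓞 K)), ((3 : ℕ) : 𝓞 K) ∈ 𝔭'.asIdeal → 𝔭' ≠ 𝔭 →
        ∀ (ι' : PadicAlgCl 3 ≃+* ℂ), SchneiderFree.BranchInducesPrime 3 ι' 𝔭 →
        ∃ (ΩK : ℂ) (Ωp : ℂ_[3]) (L : UnrSeries 3), ΩK ≠ 0 ∧ Ωp ≠ 0 ∧ IsBDPLFunction ι' 𝔭 κ γ Dt'.f ΩK Ωp L ∧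
          (Module.IsTorsion (IwasawaAlgebra 3) (XAc (W'.baseChange K) 3 κ 𝔭' ∅ γ) →
            ∀ (g : UnrSeries 3) (n m : ℕ),
              (XAc.charIdeal (W'.baseChange K) 3 κ 𝔭' ∅ γ).map (PowerSeries.map (toUnr 3)) = Ideal.span {g} →
              (∀ i < n, ‖((PowerSeries.coeff i g : unrIntegers 3) : ℂ_[3])‖ < 1) ∧
                  ‖((PowerSeries.coeff n g : unrIntegers 3) : ℂ_[3])‖ = 1 →
              (∀ i < m, ‖((PowerSeries.coeff i L : unrIntegers 3) : ℂ_[3])‖ < 1) ∧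
                  ‖((PowerSeries.coeff m L : unrIntegers 3) : ℂ_[3])‖ = 1 →
              m ≤ n)))
    (hsupply : GoodSSApZeroTwinSupplyAtThree) (hR : PeuRamifieMultTwinResupplyAtThree) (hW : WildSplitPrintedInputsAtThree)
    (hS : WildSplitFrameAtThreeOddOfPrint) (hL : ToricPrintedLeavesAtThree) (hZ : WildRankZeroTwistAtThree) :
    Summit.BirchSwinnertonDyer.WAllExclAddWildRankOneSurjTwin :=
  Summit.BirchSwinnertonDyer.wAllExclAddWildRankOneSurjTwin_of_forall
    (bsdp_three_of_degreePackage_of_print hF hP.1 hP.2.1 hP.2.2 h3 hsupply hR hW hS hL hZ)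

end Summit.BirchSwinnertonDyer.BirchSwinnertonDyer.Theorems.UniversalToricDescentKernelDegreeOnlyTwinOfPrint

end
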